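import Summits.BirchSwinnertonDyer.BirchSwinnertonDyer.Theorems.ByReductionTypeAtTwoMultUpperHalfTowerNonsplitIrrKernel
import HarnessLib

/-!
# Route `ByReductionTypeAtTwo`, crux `MultUpperHalfAtTwo` (item stmt-BirchSwinnertonDyer-19922): the either-sign TOWER class
# door WITHOUT the Thm-4.1-analogue print binder `h41ns'` — at a SPLIT certified member it is idle (vacuous display), at an
# `E[2]`-IRREDUCIBLE NON-SPLIT one it is kernel (GEN 30)

HONEST FRAMING (cell `bsd-2adic`, run/shared/lean/pub/bsd-2adic/, seat `bsd-2adic-tower-1` GEN 30, HUMAN RULINGS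
D-0036 / D-0054 / D-0074): THEOREMS ONLY (no definition, no named fact, no `sorry`); closes no item; nothing booked; no
class display re-keyed (D-0152: the 738 class files citing `missingUpperBoundAt_two_mult_of_towerGapMember'` keep their
binder until a planner says otherwise); BSD is not proved by any of this. PARTITION: X5@2 mult (K4ᵐ 19922) TOWER rows ×
p = 2 — types-the-object-of; closes none.

The GEN 3 either-sign class door `missingUpperBoundAt_two_mult_of_towerGapMember'` displays
`h41ns' : Greenberg1999.thm41Analogue_charValue_rankZero_numberField_anyPrime_oddLocalDegree`, used ONLY to produce the
non-split control display `O1.TwoAdicEulerCharRankZeroNonsplitMult W₁ 0` at the certified member `W₁`. That display is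
(a) VACUOUS when `W₁` is SPLIT multiplicative at `2` (its second guard), and (b) a KERNEL theorem when `W₁` is `E[2]`-irreducible
(`twoAdicEulerCharRankZeroNonsplitMult_zero_of_irr`, GEN 30 parts 5–12). Hence:

* `twoAdicEulerCharRankZeroNonsplitMult_of_split` — the display at a split-multiplicative curve (vacuous);
* `missingUpperBoundAt_two_mult_of_towerGapMember_split` — the either-sign class door at a SPLIT certified member, without
  `h41ns'`: PRINT {A236 `h41sp`, `hmod`, `hGZK`, `hCassels`, `hC`} + MEMO {`hKato` RC-2, `hGS` RC-4} + certificate + period datum;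
* `missingUpperBoundAt_two_mult_of_towerGapMember_irr` — the either-sign class door at an `E[2]`-IRREDUCIBLE certified member
  (either sign), without `h41ns'`: same PRINT/MEMO list, the period datum being the `Irr` branch.
What is NOT covered: a non-split `E[2]`-REDUCIBLE certified member (`E(ℚ)[2] ≠ 0`; Greenberg Prop. 4.9's road) — there the
GEN 3 door with `h41ns'` remains the only one.

References: R. Greenberg, LNM 1716 (1999), §3 p. 93, §4 pp. 112–113; K. Kato, Astérisque 295 (2004), Thm. 17.4, §17.13;
B. Mazur, J. Tate, J. Teitelbaum, Invent. Math. 84 (1986), §I.10, §I.14; K. Česnavičius (2018) Thm. 1.2;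
J. W. S. Cassels, Arithmetic VIII (1965); R. L. Miller, LMS J. Comput. Math. 14 (2011) Def. 1.1.
-/

set_option autoImplicit false
-- the Theorems namespace of this sub repeats the summit name by design (D-0017 nested layout: Summit.<S>.<Sub>)
set_option linter.dupNamespace false

noncomputable section

open scoped Classical MatrixGroups ModularForm

open NumberField IsDedekindDomain CongruenceSubgroup WeierstrassCurve Literature.NumberTheory.EllipticCurves
  Literature.NumberTheory.EllipticCurves.ModularForms
  Literature.NumberTheory.EllipticCurves.Greenberg1999
  Literature.NumberTheory.EllipticCurves.Rank1Residual
  Literature.NumberTheory.EllipticCurves.Rank1Residual.Typed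
  Summit.BirchSwinnertonDyer.Rank1Residual.X5

namespace Summit.BirchSwinnertonDyer.BirchSwinnertonDyer.Theorems

/-- At a SPLIT multiplicative `2` the non-split control display `O1.TwoAdicEulerCharRankZeroNonsplitMult W δ` holds VACUOUSLY
(its guard `¬ W.HasSplitMultiplicativeReductionAtPrime 2`). [folklore] -/
theorem twoAdicEulerCharRankZeroNonsplitMult_of_split (W : WeierstrassCurve ℚ) [W.IsElliptic] [W.IsGloballyMinimal] (δ : ℤ)
    (hsp : W.HasSplitMultiplicativeReductionAtPrime 2) : O1.TwoAdicEulerCharRankZeroNonsplitMult W δ :=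
  fun _ hns => absurd hsp hns

/-- **ROAD (vi) for the class at a SPLIT certified member, without `h41ns'`.** As `missingUpperBoundAt_two_mult_of_towerGapMember'`
(either-sign; PRINT {A236 `h41sp`, `hmod`, `hGZK`, `hCassels`, `hC`} + MEMO {`hKato` RC-2, `hGS` RC-4} + a tower-gap certificate and
a period datum at `W₁ ~_ℚ W`), for a member `W₁` that is SPLIT multiplicative at `2`: the Thm-4.1-analogue binder `h41ns'` is
idle there (`twoAdicEulerCharRankZeroNonsplitMult_of_split`) and is dropped. [cite: GreenbergLNM1716, §3 Note (p. 93) and §4 pp. 112–113]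
[cite: MazurTateTeitelbaum1986Invent, §I.10 and §I.14] [cite: Cesnavicius2018, Thm. 1.2] [cite: Cassels1965ArithmeticVIII]
[cite: Washington1997, §13.2] [cite: Miller2011LMS, Def. 1.1] -/
theorem missingUpperBoundAt_two_mult_of_towerGapMember_split
    (hKato : ∀ (W : WeierstrassCurve ℚ) [W.IsElliptic] [W.IsGloballyMinimal],
      ¬ W.HasCM → Mult W 2 → O1.KatoMultiplicativeDivisibilityRat W 2)
    (h41sp : thm41Analogue_charValue_rankZero_split_baseChange_anyPrime)
    (hmod : nonempty_modularParametrizationData)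
    (hGZK : rank_eq_analyticRank_of_analyticRank_le_one)
    (hCassels : bsdRHS_eq_of_isIsogenous)
    (hC : cesnavicius_not_two_dvd_maninConstant_of_two_dvd_level)
    (hGS : ∀ (W : WeierstrassCurve ℚ) [W.IsElliptic] [W.IsGloballyMinimal],
      W.HasSplitMultiplicativeReductionAtPrime 2 → greenberg_stevens (W := W) (p := 2))
    (W : WeierstrassCurve ℚ) [W.IsElliptic] [W.IsGloballyMinimal]
    (hr : W.analyticRank = 0) (hmult : Mult W 2)
    (W₁ : WeierstrassCurve ℚ) [W₁.IsElliptic] [W₁.IsGloballyMinimal] (hiso : IsIsogenous W W₁)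
    (hsp₁ : W₁.HasSplitMultiplicativeReductionAtPrime 2)
    (hgap : O1.TowerGapAtTwo W₁)
    (hB : Irr W₁ 2 ∨
      (∀ [NeZero (W₁.conductorNorm ℤ)],
        ∃ D : ModularParametrizationData W₁ (W₁.conductorNorm ℤ), Zhai2021.IsOptimalDatum W₁ D) ∨
      (∀ [NeZero (W₁.conductorNorm ℤ)] (f : CuspForm (Gamma0 (W₁.conductorNorm ℤ)) 2),
        IsNewformOf W₁ f → ∀ ϖ : ℚ, (ϖ : ℝ) * W₁.realPeriodRat = plusPeriod f →
          0 ≤ padicValRat 2 ϖ)) :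
    MissingUpperBoundAt W 2 := by
  have hmult₁ : Mult W₁ 2 :=
    Summit.BirchSwinnertonDyer.Rank1Residual.X2.IsogenyQuotientLine.hasMultiplicativeReductionAtPrime_of_isIsogenous
      hiso hmult
  have hr₁ : W₁.analyticRank = 0 := (analyticRank_eq_of_isIsogenous' hiso).symm.trans hr
  have hcm₁ : ¬ W₁.HasCM := fun h ↦ Rank1Residual.not_mult_of_hasCM W₁ h 2 hmult₁
  have hper₁ : ∀ [NeZero (W₁.conductorNorm ℤ)] (f : CuspForm (Gamma0 (W₁.conductorNorm ℤ)) 2),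
      IsNewformOf W₁ f → ∀ ϖ : ℚ, (ϖ : ℝ) * W₁.realPeriodRat = plusPeriod f → 0 ≤ padicValRat 2 ϖ := by
    rcases hB with hirr | hopt | hper
    · intro _ f hf ϖ hϖ
      exact (padicValRat_periodRatio_eq_zero_of_irr_two hC W₁ hmult₁ hirr f hf ϖ hϖ).ge
    · intro _ f hf ϖ hϖ
      obtain ⟨D, hD⟩ := hopt
      exact (padicValRat_periodRatio_eq_zero_of_isOptimalDatum hC W₁ hmult₁ D hD f hf ϖ hϖ).ge
    · exact hper
  have hU₁ : MissingUpperBoundAt W₁ 2 :=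
    missingUpperBoundAt_two_mult_of_towerGap_of_eulerChar W₁ (hKato W₁ hcm₁ hmult₁)
      (twoAdicEulerCharRankZeroNonsplitMult_of_split W₁ 0 hsp₁) h41sp hmod hGZK (hGS W₁) hper₁ hgap hr₁ hmult₁
  exact missingUpperBoundAt_two_of_isogenous_member hmod hGZK hCassels W hr W₁ hiso hU₁

/-- **ROAD (vi) for the class at an `E[2]`-IRREDUCIBLE certified member (either sign at `2`), without `h41ns'`.** As
`missingUpperBoundAt_two_mult_of_towerGapMember'` for a member `W₁ ~_ℚ W` with `Irr W₁ 2` (the period datum is then PRINT: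
Česnavičius `hC`): the Thm-4.1-analogue binder is KERNEL there (`twoAdicEulerCharRankZeroNonsplitMult_zero_of_irr`, GEN 30)
and is dropped; PRINT {A236 `h41sp`, `hmod`, `hGZK`, `hCassels`, `hC`} + MEMO {`hKato` RC-2, `hGS` RC-4} + certificate.
[cite: GreenbergLNM1716, §3 Note (p. 93) and §4 pp. 112–113] [cite: MazurTateTeitelbaum1986Invent, §I.10 and §I.14]
[cite: Cesnavicius2018, Thm. 1.2] [cite: Cassels1965ArithmeticVIII] [cite: Washington1997, §13.2] [cite: Miller2011LMS, Def. 1.1] -/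
theorem missingUpperBoundAt_two_mult_of_towerGapMember_irr
    (hKato : ∀ (W : WeierstrassCurve ℚ) [W.IsElliptic] [W.IsGloballyMinimal],
      ¬ W.HasCM → Mult W 2 → O1.KatoMultiplicativeDivisibilityRat W 2)
    (h41sp : thm41Analogue_charValue_rankZero_split_baseChange_anyPrime)
    (hmod : nonempty_modularParametrizationData)
    (hGZK : rank_eq_analyticRank_of_analyticRank_le_one)
    (hCassels : bsdRHS_eq_of_isIsogenous)
    (hC : cesnavicius_not_two_dvd_maninConstant_of_two_dvd_level)
    (hGS : ∀ (W : WeierstrassCurve ℚ) [W.IsElliptic] [W.IsGloballyMinimal],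
      W.HasSplitMultiplicativeReductionAtPrime 2 → greenberg_stevens (W := W) (p := 2))
    (W : WeierstrassCurve ℚ) [W.IsElliptic] [W.IsGloballyMinimal]
    (hr : W.analyticRank = 0) (hmult : Mult W 2)
    (W₁ : WeierstrassCurve ℚ) [W₁.IsElliptic] [W₁.IsGloballyMinimal] (hiso : IsIsogenous W W₁)
    (hgap : O1.TowerGapAtTwo W₁) (hirr₁ : Irr W₁ 2) :
    MissingUpperBoundAt W 2 := by
  have hmult₁ : Mult W₁ 2 :=
    Summit.BirchSwinnertonDyer.Rank1Residual.X2.IsogenyQuotientLine.hasMultiplicativeReductionAtPrime_of_isIsogenous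
      hiso hmult
  have hr₁ : W₁.analyticRank = 0 := (analyticRank_eq_of_isIsogenous' hiso).symm.trans hr
  have hcm₁ : ¬ W₁.HasCM := fun h ↦ Rank1Residual.not_mult_of_hasCM W₁ h 2 hmult₁
  have hper₁ : ∀ [NeZero (W₁.conductorNorm ℤ)] (f : CuspForm (Gamma0 (W₁.conductorNorm ℤ)) 2),
      IsNewformOf W₁ f → ∀ ϖ : ℚ, (ϖ : ℝ) * W₁.realPeriodRat = plusPeriod f → 0 ≤ padicValRat 2 ϖ :=
    fun f hf ϖ hϖ ↦ (padicValRat_periodRatio_eq_zero_of_irr_two hC W₁ hmult₁ hirr₁ f hf ϖ hϖ).ge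
  have hU₁ : MissingUpperBoundAt W₁ 2 :=
    missingUpperBoundAt_two_mult_of_towerGap_of_eulerChar W₁ (hKato W₁ hcm₁ hmult₁)
      (twoAdicEulerCharRankZeroNonsplitMult_zero_of_irr W₁ hirr₁) h41sp hmod hGZK (hGS W₁) hper₁ hgap hr₁ hmult₁
  exact missingUpperBoundAt_two_of_isogenous_member hmod hGZK hCassels W hr W₁ hiso hU₁

end Summit.BirchSwinnertonDyer.BirchSwinnertonDyer.Theorems

end
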